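import Mathlib.LinearAlgebra.Dimension.Finrank
import Mathlib.LinearAlgebra.Quotient.Basic
import Mathlib.Data.Int.Interval
import Mathlib.Algebra.BigOperators.Group.Finset.Basic
import Literature.AlgebraicGeometry.Motives.Varieties
import Literature.AlgebraicGeometry.Motives.Cycles
import Literature.AlgebraicGeometry.Motives.PreWeilCohomology
import Literature.AlgebraicGeometry.Motives.WeilCohomology
import HarnessLib

-- provenance: harness21/H21/H21/Prelude/MotiveL/DeRhamRealization.lean @ 154134c (interim HEAD d8f2665); M5 mechanical rewrite
/-!
# Algebraic de Rham cohomology as a hypothesis structure (trunk MotiveL, prelude C8)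

For a field `k` of characteristic zero, algebraic de Rham cohomology
`X ↦ H•_dR(X/k) = ℍ•(X, Ω•_{X/k})` (Grothendieck 1966) is a Weil cohomology theory on smooth
projective `k`-varieties with coefficients in `k` itself, and each `Hⁱ_dR(X/k)` carries the
**Hodge filtration** `Fᵖ Hⁱ_dR(X/k) = Im (ℍⁱ(X, Ω^{≥ p}) → ℍⁱ(X, Ω•))`, a finite decreasing
filtration by `k`-subspaces, functorial, multiplicative, with `F⁰ = Hⁱ`, `F^{i+1} = 0`, whose
graded pieces are `gr_F^p Hⁱ = H^{i-p}(X, Ωᵖ)` (degeneration of the Hodge-to-de Rham spectral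
sequence at `E₁`, Deligne 1968 / Hodge II §§1–3), with Hodge symmetry `h^{p,q} = h^{q,p}` and with
the class of a codimension-`p` cycle lying in `Fᵖ H²ᵖ`.

Following the two-speed design of the trunk (every realization is a *value candidate* of the
G17 record `Literature.AlgebraicGeometry.Motives.WeilCohomology`), this file records these facts as a **hypothesis structure**
`Literature.DeRhamRealization k extends Literature.WeilCohomology k k`: the extra datum is the filtration
`D.fil i : ℤ → Submodule k (Hⁱ(X))`, and the extra axioms are the listed properties. The graded
pieces `D.gr X i p`, the Hodge numbers `D.hodgeNumber X i p q` (nonzero only for `p + q = i`;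
`E₁`-degeneration is thereby built in) and the Betti numbers `D.bettiNumber X i` are DEFINED, and
the Hodge-symmetry axiom is stated with the defined Hodge numbers (through the auxiliary
`Literature.AlgebraicGeometry.Motives.hodgeNumberOfFiltration`, so that it can appear as a field).

## What is NOT expressible here

* `h^{p,q}(X) = dim_k H^q(X, Ωᵖ_{X/k})`: Mathlib's sheaf cohomology `Sheaf.H` of a sheaf of
  modules is an abelian group without its `k`-vector space structure, and there is no de Rham
  complex / hypercohomology of a complex of sheaves. The honest anchor is item C15
  `Differentials` (`cotangentSheaf X = Ω¹_{X/k}` as an `X.Modules`, `H^q(X, Ω¹)` and `H^q(X, 𝒪_X)`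
  as groups).
* The definition `Hⁱ_dR(X/k) := ℍⁱ(X, Ω•_{X/k})` itself, for the same reason; hence the
  hypothesis-structure form.

## Main definitions

* `Literature.gradedPiece F p = F p / F (p+1)` and `Literature.hodgeNumberOfFiltration F i p q` for a
  `ℤ`-indexed filtration `F` by submodules (auxiliary, stated before the structure).
* `Literature.DeRhamRealization k` : the hypothesis structure.
* `D.gr X i p`, `D.hodgeNumber X i p q`, `D.bettiNumber X i`.
* API: `D.fil_zero_eq_top`, `D.hodgeNumber_eq_zero_of_neg`, `D.hodgeNumber_symm`,
  `D.sum_hodgeNumber` (`∑_{p=0}^{i} h^{p,i-p} = bᵢ`), `D.mem_fil_of_mem_algebraicClasses`.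

## Design choices

* Mathlib has no algebraic de Rham cohomology, Hodge filtration or Hodge numbers (searched
  `deRham`, `HodgeFiltration`, `hodgeNumber`, `gradedPiece` in Mathlib: nothing relevant; only
  `KaehlerDifferential` and `PresheafOfModules.DifferentialsConstruction`, used by C15). We use
  Mathlib's `Submodule.comap/map`, quotient modules, `Module.finrank`, `Finset.Icc` on `ℤ`.
* As in `Literature.AlgebraicGeometry.Motives.WeilCohomology`, the data (`fil`) is defined on all `k`-schemes but the axioms
  involving pull-backs, cup products, cycle classes, vanishing and symmetry are only imposed on
  smooth projective varieties (`IsSmoothProjective n X → …`); `antitone_fil` and `fil_nonpos`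
  are harmless unconditionally.
* The filtration is indexed by `ℤ` (as `Literature.AlgebraicGeometry.Motives.HodgeStructure.F` in G17), cohomological degrees by
  `ℕ`; the comparison `(i : ℤ) < p` is a cast, never an `ℕ`-subtraction.
* Junk values: `hodgeNumber X i p q = 0` if `p + q ≠ i` (by definition) and `finrank = 0` on
  infinite-dimensional pieces (they are finite dimensional on smooth projective `X` by
  `finite_obj`).

## References

* A. Grothendieck, *On the de Rham cohomology of algebraic varieties*, Publ. IHÉS 29 (1966).
* P. Deligne, *Théorie de Hodge II*, Publ. IHÉS 40 (1971), §§1–3 (filtrations 1.1, Hodge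
  filtration and `E₁`-degeneration 2.2–2.3, Hodge numbers 2.3.7).
* P. Deligne, *Théorème de Lefschetz et critères de dégénérescence de suites spectrales*,
  Publ. IHÉS 35 (1968) (algebraic `E₁`-degeneration in characteristic zero).
-/

universe u

open CategoryTheory AlgebraicGeometry Opposite

noncomputable section

namespace Literature.AlgebraicGeometry.Motives

/-! ## Graded pieces of a filtration -/

section Filtration

variable {R : Type*} [Ring R] {V : Type*} [AddCommGroup V] [Module R V]

/-- The `p`-th graded piece `gr_F^p V = Fᵖ V / F^{p+1} V` of a decreasing `ℤ`-filtration `F` of a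
module `V` by submodules (Deligne, Hodge II, 1.1.7), realised as the quotient of `↥(F p)` by the
preimage of `F (p + 1)` under the inclusion (no `F (p+1) ≤ F p` is needed to form it). [folklore] -/
abbrev gradedPiece (F : ℤ → Submodule R V) (p : ℤ) : Type _ :=
  ↥(F p) ⧸ (F (p + 1)).comap (F p).subtype

/-- The Hodge number attached to a filtration `F` on a cohomology group of degree `i`:
`h^{p,q} = dim gr_F^p` if `p + q = i` and `0` otherwise (Deligne, Hodge II, 2.3.7, with the
`E₁`-degeneration `gr_F^p Hⁱ_dR = H^{i-p}(Ωᵖ)` built in). Auxiliary for the field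
`DeRhamRealization.hodge_symm`; use `DeRhamRealization.hodgeNumber`. [folklore] -/
def hodgeNumberOfFiltration (F : ℤ → Submodule R V) (i : ℕ) (p q : ℤ) : ℕ :=
  if p + q = i then Module.finrank R (gradedPiece F p) else 0

end Filtration

/-! ## The hypothesis structure -/

/-- An **algebraic de Rham realization** over a field `k` of characteristic zero
(Grothendieck 1966; Deligne, Hodge II (1971), §§1–3): a Weil cohomology theory `X ↦ H•_dR(X/k)`
with coefficients in `k`, together with the Hodge filtration `Fᵖ Hⁱ_dR(X)` on each cohomology
group, subject to: `F` is decreasing, `Fᵖ = Hⁱ` for `p ≤ 0`; and, on smooth projective `X`,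
`Fᵖ Hⁱ = 0` for `p > i`, pull-backs and cup products respect `F` (`f* Fᵖ ⊆ Fᵖ`,
`Fᵖ ∪ F^q ⊆ F^{p+q}`), the class of a codimension-`p` cycle lies in `Fᵖ H²ᵖ`, and Hodge
symmetry `h^{p,q} = h^{q,p}` holds for the Hodge numbers `h^{p,i-p} = dim gr_F^p Hⁱ`.
The classical realization (algebraic de Rham cohomology with its Hodge filtration) is a value of
this structure; that fact is not expressible in Mathlib (no hypercohomology of `Ω•_{X/k}`). [cite: Grothendieck1966] -/
structure DeRhamRealization (k : Type u) [Field k] [CharZero k] extends WeilCohomology k k where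
  /-- The Hodge filtration `p ↦ Fᵖ Hⁱ_dR(X)` by `k`-subspaces (Deligne, Hodge II, 2.2). -/
  fil ⦃X : SchemeOver k⦄ (i : ℕ) : ℤ → Submodule k (toPreWeilCohomology.obj X i)
  /-- The Hodge filtration is decreasing: `p ≤ q → F^q ⊆ Fᵖ` (Hodge II, 1.1). -/
  antitone_fil : ∀ (X : SchemeOver k) (i : ℕ), Antitone (fil (X := X) i)
  /-- `Fᵖ Hⁱ = Hⁱ` for `p ≤ 0` (Hodge II, 2.2: `Ω^{≥ p} = Ω•` for `p ≤ 0`). -/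
  fil_nonpos : ∀ (X : SchemeOver k) (i : ℕ) ⦃p : ℤ⦄, p ≤ 0 → fil (X := X) i p = ⊤
  /-- `Fᵖ Hⁱ = 0` for `p > i` on a smooth projective `X` (Hodge II, 2.3.7: `h^{p,q} = 0` unless
  `0 ≤ p, q`). -/
  fil_eq_bot : ∀ ⦃n : ℕ⦄ ⦃X : SchemeOver k⦄, IsSmoothProjective n X →
    ∀ (i : ℕ) ⦃p : ℤ⦄, (i : ℤ) < p → fil (X := X) i p = ⊥
  /-- Pull-backs respect the Hodge filtration: `f* (Fᵖ Hⁱ(Y)) ⊆ Fᵖ Hⁱ(X)` (Hodge II, 2.2,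
  functoriality of `Ω^{≥ p}`). -/
  pullback_fil_le : ∀ ⦃n : ℕ⦄ ⦃X : SchemeOver k⦄, IsSmoothProjective n X →
    ∀ ⦃m : ℕ⦄ ⦃Y : SchemeOver k⦄, IsSmoothProjective m Y → ∀ (f : X ⟶ Y) (i : ℕ) (p : ℤ),
      (fil i p).map (toPreWeilCohomology.pullback f i) ≤ fil i p
  /-- The cup product respects the Hodge filtration: `Fᵖ Hⁱ ∪ F^q Hʲ ⊆ F^{p+q} Hⁱ⁺ʲ`
  (Hodge II, 2.2, `Ω^{≥ p} ⊗ Ω^{≥ q} → Ω^{≥ p+q}`). -/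
  cup_fil_le : ∀ ⦃n : ℕ⦄ ⦃X : SchemeOver k⦄, IsSmoothProjective n X →
    ∀ ⦃i j l : ℕ⦄ (h : i + j = l) (p q : ℤ) (a : toPreWeilCohomology.obj X i)
      (b : toPreWeilCohomology.obj X j), a ∈ fil i p → b ∈ fil j q → cup h a b ∈ fil l (p + q)
  /-- The de Rham class of a codimension-`p` prime cycle lies in `Fᵖ H²ᵖ` (it is of Hodge type
  `(p, p)`; Grothendieck 1966, Deligne 1971 §2). -/
  cycleClass_mem_fil : ∀ ⦃n : ℕ⦄ ⦃X : SchemeOver k⦄, IsSmoothProjective n X →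
    ∀ (p : ℕ) (z : X.left), Order.coheight z = p → cycleClass X p z ∈ fil (2 * p) p
  /-- Hodge symmetry `h^{p,q}(X) = h^{q,p}(X)` on a smooth projective `X`, for the Hodge numbers
  `h^{p,q} = dim_k gr_F^p H^{p+q}_dR(X)` (Hodge II, 2.3.7; via comparison with Hodge theory).
  Stated with `hodgeNumberOfFiltration`; see `DeRhamRealization.hodgeNumber_symm`. -/
  hodge_symm : ∀ ⦃n : ℕ⦄ ⦃X : SchemeOver k⦄, IsSmoothProjective n X →
    ∀ (i : ℕ) (p q : ℤ),
      hodgeNumberOfFiltration (fil (X := X) i) i p q = hodgeNumberOfFiltration (fil (X := X) i) i q p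

namespace DeRhamRealization

variable {k : Type u} [Field k] [CharZero k] (D : DeRhamRealization k)

/-! ## Graded pieces, Hodge numbers, Betti numbers -/

/-- The graded piece `gr_F^p Hⁱ_dR(X) = Fᵖ Hⁱ / F^{p+1} Hⁱ` (Deligne, Hodge II, 1.1.7; on a smooth
projective `X` it "is" `H^{i-p}(X, Ωᵖ)`, Hodge II 2.3.7 — not expressible, see the module
docstring). [folklore] -/
abbrev gr (X : SchemeOver k) (i : ℕ) (p : ℤ) : Type u :=
  gradedPiece (D.fil (X := X) i) p

/-- The Hodge number `h^{p,q}(X) := dim_k gr_F^p H^{p+q}_dR(X)`, read in degree `i`: it is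
`finrank k (D.gr X i p)` if `p + q = i` and `0` otherwise (Deligne, Hodge II, 2.3.7). [folklore] -/
def hodgeNumber (X : SchemeOver k) (i : ℕ) (p q : ℤ) : ℕ :=
  if p + q = i then Module.finrank k (D.gr X i p) else 0

/-- The `i`-th Betti number of `X` for the de Rham realization, `bᵢ(X) = dim_k Hⁱ_dR(X/k)`
(Grothendieck 1966: equal to the topological Betti number by the comparison theorem). [cite: Grothendieck1966, Thm. 1'] -/
def bettiNumber (X : SchemeOver k) (i : ℕ) : ℕ :=
  Module.finrank k (D.obj X i)

/-- `D.hodgeNumber` is the auxiliary `hodgeNumberOfFiltration` of the Hodge filtration. [folklore] -/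
lemma hodgeNumber_eq_hodgeNumberOfFiltration (X : SchemeOver k) (i : ℕ) (p q : ℤ) :
    D.hodgeNumber X i p q = hodgeNumberOfFiltration (D.fil (X := X) i) i p q := rfl

/-- `h^{p,q} = 0` unless `p + q = i` (built-in `E₁`-degeneration bookkeeping). [folklore] -/
lemma hodgeNumber_of_add_ne (X : SchemeOver k) (i : ℕ) {p q : ℤ} (h : p + q ≠ i) :
    D.hodgeNumber X i p q = 0 := by
  simp [hodgeNumber, h]

/-! ## API -/

section API

variable (X : SchemeOver k) (i : ℕ)

/-- `F⁰ Hⁱ_dR(X) = Hⁱ_dR(X)` (Deligne, Hodge II, 2.2). [folklore] -/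
@[simp]
lemma fil_zero_eq_top : D.fil (X := X) i 0 = ⊤ :=
  D.fil_nonpos X i le_rfl

/-- `F^q ⊆ Fᵖ` for `p ≤ q`. [folklore] -/
lemma fil_le_fil {p q : ℤ} (h : p ≤ q) : D.fil (X := X) i q ≤ D.fil (X := X) i p :=
  D.antitone_fil X i h

/-- `h^{p,q}(X) = 0` for `p < 0`: then `Fᵖ = F^{p+1} = Hⁱ`, so `gr_F^p = 0`
(Deligne, Hodge II, 2.3.7). [folklore] -/
lemma hodgeNumber_eq_zero_of_neg {p : ℤ} (hp : p < 0) (q : ℤ) : D.hodgeNumber X i p q = 0 := by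
  unfold hodgeNumber
  split_ifs
  · have htop : (D.fil (X := X) i (p + 1)).comap (D.fil (X := X) i p).subtype = ⊤ := by
      rw [D.fil_nonpos X i (show p + 1 ≤ 0 by omega), Submodule.comap_top]
    haveI : Subsingleton (D.gr X i p) := by
      change Subsingleton (↥(D.fil i p) ⧸ (D.fil i (p + 1)).comap (D.fil i p).subtype)
      rw [htop]
      infer_instance
    exact Module.finrank_zero_of_subsingleton
  · rfl

variable {X} {n : ℕ}

/-- **Hodge symmetry** `h^{p,q}(X) = h^{q,p}(X)` for a smooth projective `X`, in terms of the
defined `hodgeNumber` (the axiom `hodge_symm`; Deligne, Hodge II, 2.3.7). [folklore] -/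
theorem hodgeNumber_symm (hX : IsSmoothProjective n X) (i : ℕ) (p q : ℤ) :
    D.hodgeNumber X i p q = D.hodgeNumber X i q p :=
  D.hodge_symm hX i p q

/-- `h^{p,q}(X) = 0` for `p > i` (`p + q = i`) on a smooth projective `X`: `Fᵖ Hⁱ = 0`
(Deligne, Hodge II, 2.3.7). [folklore] -/
lemma hodgeNumber_eq_zero_of_lt (hX : IsSmoothProjective n X) (i : ℕ) {p : ℤ} (hp : (i : ℤ) < p)
    (q : ℤ) : D.hodgeNumber X i p q = 0 := by
  unfold hodgeNumber
  split_ifs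
  · haveI : Subsingleton (D.gr X i p) := by
      change Subsingleton (↥(D.fil i p) ⧸ (D.fil i (p + 1)).comap (D.fil i p).subtype)
      rw [D.fil_eq_bot hX i hp]
      infer_instance
    exact Module.finrank_zero_of_subsingleton
  · rfl

/-- The Hodge numbers of a smooth projective `X` sum to the Betti number:
`∑_{p=0}^{i} h^{p,i-p}(X) = dim_k Hⁱ_dR(X)` (Deligne, Hodge II, 2.3.7 with `E₁`-degeneration;
formally: `dim` is additive along the finite filtration `Hⁱ = F⁰ ⊇ F¹ ⊇ ⋯ ⊇ F^{i+1} = 0` of the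
finite-dimensional space `Hⁱ`). Depends only on: `finite_obj`, `antitone_fil`, `fil_nonpos`,
`fil_eq_bot`. A named fact (statement only; a discharge candidate: it is a formal consequence of
the listed axioms). [cite: DeligneHodgeII1971, 2.3.7] -/
def sum_hodgeNumber : Prop :=
  ∀ (hX : IsSmoothProjective n X) (i : ℕ),
    ∑ p ∈ Finset.Icc (0 : ℤ) i, D.hodgeNumber X i p (i - p) = D.bettiNumber X i

/-- The `k`-span of the classes of codimension-`p` cycles lies in `Fᵖ H²ᵖ_dR(X)` for a smooth
projective `X` (from `cycleClass_mem_fil`; Deligne 1971 §2: algebraic classes are of type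
`(p, p)`). [cite: DeligneHodgeII1971, §2] -/
theorem mem_fil_of_mem_algebraicClasses (hX : IsSmoothProjective n X) (p : ℕ)
    {x : D.obj X (2 * p)} (hx : x ∈ D.algebraicClasses X p) : x ∈ D.fil (2 * p) p := by
  refine (Submodule.span_le.mpr ?_) hx
  change D.algebraicLattice X p ≤ (D.fil (X := X) (2 * p) p).toAddSubgroup
  refine (AddSubgroup.closure_le _).mpr ?_
  rintro _ ⟨⟨z, hz⟩, rfl⟩
  exact D.cycleClass_mem_fil hX p z hz

/-- The Betti number vanishes above degree `2 dim X` (`subsingleton_obj`). [folklore] -/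
lemma bettiNumber_eq_zero (hX : IsSmoothProjective n X) {i : ℕ} (hi : 2 * n < i) :
    D.bettiNumber X i = 0 :=
  D.finrank_obj_eq_zero hX hi

end API

end DeRhamRealization

/-! ## Discharge of `sum_hodgeNumber`

`finrank` is additive along a finite filtration of a finite-dimensional vector space; applied to
the Hodge filtration `Hⁱ = F⁰ ⊇ F¹ ⊇ ⋯ ⊇ F^{i+1} = 0` of a smooth projective `X` this gives
`∑_{p=0}^{i} h^{p,i-p}(X) = bᵢ(X)` (Deligne, Hodge II, 2.3.7; classical form
`bᵏ = ∑_{p+q=k} h^{p,q}`: Cattani–El Zein–Griffiths–Lê, *Hodge Theory* (2014), (1.5.8)). -/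

section FiltrationRank

variable {K : Type*} [DivisionRing K] {V : Type*} [AddCommGroup V] [Module K V]

/-- One step of the additivity of `finrank` along a filtration of a finite-dimensional space:
`dim gr_F^p V + dim F^{p+1} V = dim F^p V` whenever `F^{p+1} V ⊆ F^p V`. [folklore] -/
lemma finrank_gradedPiece_add_finrank [FiniteDimensional K V] (F : ℤ → Submodule K V) (p : ℤ)
    (h : F (p + 1) ≤ F p) :
    Module.finrank K (gradedPiece F p) + Module.finrank K (F (p + 1)) =
      Module.finrank K (F p) := by
  rw [← (Submodule.comapSubtypeEquivOfLe h).finrank_eq]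
  exact Submodule.finrank_quotient_add_finrank _

/-- Telescoping `finrank` along a decreasing filtration `V = F⁰ ⊇ F¹ ⊇ ⋯` of a finite-dimensional
space: `∑_{0 ≤ p < m} dim gr_F^p V + dim F^m V = dim V`. [folklore] -/
lemma sum_finrank_gradedPiece_add_finrank [FiniteDimensional K V] (F : ℤ → Submodule K V)
    (hF : Antitone F) (h0 : F 0 = ⊤) (m : ℕ) :
    (∑ p ∈ Finset.range m, Module.finrank K (gradedPiece F p)) + Module.finrank K (F m) =
      Module.finrank K V := by
  induction m with
  | zero => rw [Finset.sum_range_zero, zero_add, Nat.cast_zero, h0, finrank_top]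
  | succ m ih =>
      have hc : ((m + 1 : ℕ) : ℤ) = (m : ℤ) + 1 := by push_cast; rfl
      rw [Finset.sum_range_succ, hc, add_assoc,
        finrank_gradedPiece_add_finrank F m (hF (by omega))]
      exact ih

end FiltrationRank

namespace DeRhamRealization

variable {k : Type u} [Field k] [CharZero k] (D : DeRhamRealization k) {X : SchemeOver k} {n : ℕ}

/-- **Discharge of `sum_hodgeNumber`.** The Hodge numbers of a smooth projective `X` sum to the
Betti number, `∑_{p=0}^{i} h^{p,i-p}(X) = dim_k Hⁱ_dR(X)` (Deligne, Hodge II, 2.3.7; classical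
form `bᵏ = ∑_{p+q=k} h^{p,q}`, Cattani–El Zein–Griffiths–Lê, *Hodge Theory* (2014), (1.5.8)).
Formal consequence of the axioms `finite_obj`, `antitone_fil`, `fil_nonpos`, `fil_eq_bot`:
`finrank` telescopes along the finite filtration `Hⁱ = F⁰ ⊇ F¹ ⊇ ⋯ ⊇ F^{i+1} = 0`
(`Literature.AlgebraicGeometry.Motives.sum_finrank_gradedPiece_add_finrank`), and `h^{p,i-p} = dim gr_F^p Hⁱ` by definition.
[cite: DeligneHodgeII1971, 2.3.7] -/
theorem sum_hodgeNumber_holds : D.sum_hodgeNumber (X := X) (n := n) := by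
  intro hX i
  haveI : Module.Finite k (D.obj X i) := D.finite_obj hX i
  have h1 : ∀ p ∈ Finset.Icc (0 : ℤ) i,
      D.hodgeNumber X i p (i - p) = Module.finrank k (D.gr X i p) := by
    intro p _
    simp [hodgeNumber]
  have hs : Finset.Icc (0 : ℤ) i = (Finset.range (i + 1)).map Nat.castEmbedding := by
    ext p
    simp only [Finset.mem_Icc, Finset.mem_map, Finset.mem_range, Nat.castEmbedding_apply]
    constructor
    · rintro ⟨h0, hi⟩
      exact ⟨p.toNat, by omega, by omega⟩
    · rintro ⟨m, hm, rfl⟩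
      omega
  have key := sum_finrank_gradedPiece_add_finrank (D.fil (X := X) i) (D.antitone_fil X i)
    (D.fil_zero_eq_top X i) (i + 1)
  rw [D.fil_eq_bot hX i (by push_cast; omega), finrank_bot, add_zero] at key
  rw [Finset.sum_congr rfl h1, hs, Finset.sum_map]
  exact key

end DeRhamRealization

end Literature.AlgebraicGeometry.Motives

end
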